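import Mathlib.Analysis.SpecialFunctions.SmoothTransition
import Mathlib.Analysis.SpecialFunctions.Integrals.Basic
import Mathlib.Analysis.SpecialFunctions.Sqrt
import Mathlib.MeasureTheory.Integral.IntervalIntegral.FundThmCalculus
import Literature.Analysis.Calculus.HadamardLemma
import HarnessLib

/-!
# The smoothed Hill spherical vortex, I: the radial profiles `η₁`, `g'` and the tail constant

Cell `ns-blowup`, seat `ns-blowup-fc-prover-3` (g6). LABEL: kinematics (definitions with bodies + proved
lemmas; no named fact; nothing about Navier–Stokes dynamics is asserted). WHAT THIS IS NOT: not NS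
evidence — an explicit smooth vector field, used by the cell as the LAZY ENVELOPE SLICE of the negative
lane of crux `HeredityAtOne` (stmt-NavierStokesRegularity-19249; strategy census §Strengthen (e), S⁺).
Hill's spherical vortex (M. J. M. Hill, Phil. Trans. R. Soc. A 185 (1894) 213–245, Art. 1–4;
D. J. Acheson, *Elementary Fluid Dynamics*, §5.5; the tree's `HillSphericalVortex.lean` types the
printed derivation) is the axisymmetric swirl-free Euler steady state whose vorticity quotient
`η = ω_θ / r` is a positive CONSTANT `M` inside a ball and `0` outside; its velocity is the curl of
the vector potential `g(|x|²) e_z × x` with a piecewise-polynomial / dipole `g`. This file and its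
sequels (`SmoothedHillVortexPotential`, `SmoothedHillVortexField`, …) construct a `C^∞` version —
the vorticity quotient is `η(x) = η₁(|x|²)`, `η₁(s) = M φ(s)` with a smooth monotone cutoff
`φ = 1` on `s ≤ a²`, `φ = 0` on `s ≥ b²` (`0 < a < b`) — keeping CLOSED FORMS where they matter:
the exact Hill core on `|x| ≤ a` and the exact point-dipole field on `|x| ≥ b`, with two-sided
bounds in the layer. Everything is one-variable calculus in `s = |x|²`:

* `cutoff`, `quot` (`η₁`), their smoothness, values on the core / off the support, monotonicity;
* `slope` = the profile `g'(s) = −½ ∫₀¹ τ⁴ η₁(s τ²) dτ` (a parametric integral, hence smooth at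
  `s = 0`), `slope_of_le` (`g' = −M/10` on the core), `slope_mem` (`−M/10 ≤ g' ≤ 0`);
* `moment` (`m(c) = ∫₀ᶜ ρ⁴ η₁(ρ²) dρ`), `tailConst` (`K = m(b)`, `M a⁵/5 ≤ K ≤ M b⁵/5`), the
  substitution `slope_eq_moment` (`g'(s) = −½ m(√s) s^{-5/2}`, `s > 0`) and the dipole tail
  `slope_of_ge` (`g'(s) = −(K/2) s^{-5/2}` for `s ≥ b²`), `neg_slope_ge`;
* the VORTICITY IDENTITY `quot_eq_slope_deriv`: `η₁(s) = −(10 g'(s) + 4 s g''(s))` for every `s`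
  — with `u = curl (g(|x|²) e_z × x)` this is `curl u = η₁(|x|²) e_z × x` (sequel, Field file).

WHY NOT SCHWARTZ: a single-signed `η` forces the impulse `∫ r²η > 0 = 2∫u_z`, so no `L¹`
(a fortiori no compactly supported or Schwartz) divergence-free field has single-signed `ω_θ/r`;
the smoothed Hill vortex keeps the `|x|⁻³` dipole tail and is `H^∞`, not Schwartz.

References: M. J. M. Hill, Phil. Trans. R. Soc. London A 185 (1894) 213–245 [cite: Hill1894, Art. 1–4];
D. J. Acheson, *Elementary Fluid Dynamics* (OUP 1990) §5.5 [cite: Acheson1990, §5.5, eqs. (5.15)–(5.25)].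
-/

noncomputable section

open Real Set MeasureTheory intervalIntegral

namespace Summit.NavierStokesRegularity.FluidComputer

namespace SmoothedHill

variable {M a b : ℝ}

/-- The radial cutoff in the variable `s = |x|²` for radii `a < b`:
`φ(s) = smoothTransition ((b² − s)/(b² − a²))`, equal to `1` for `s ≤ a²`, to `0` for `s ≥ b²`,
smooth and valued in `[0, 1]`. [folklore] -/
def cutoff (a b s : ℝ) : ℝ := Real.smoothTransition ((b ^ 2 - s) / (b ^ 2 - a ^ 2))

/-- `a² < b²` for radii `0 ≤ a < b`. [folklore] -/
theorem sq_lt_sq_of_radii (ha : 0 ≤ a) (hab : a < b) : a ^ 2 < b ^ 2 := by nlinarith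

/-- `φ = 1` on `s ≤ a²` (for `0 ≤ a < b`). [folklore] -/
theorem cutoff_of_le (ha : 0 ≤ a) (hab : a < b) {s : ℝ} (hs : s ≤ a ^ 2) : cutoff a b s = 1 := by
  unfold cutoff
  have := sq_lt_sq_of_radii ha hab
  apply Real.smoothTransition.one_of_one_le
  rw [le_div_iff₀ (by linarith)]
  linarith

/-- `φ = 0` on `b² ≤ s` (for `0 ≤ a < b`). [folklore] -/
theorem cutoff_of_ge (ha : 0 ≤ a) (hab : a < b) {s : ℝ} (hs : b ^ 2 ≤ s) : cutoff a b s = 0 := by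
  unfold cutoff
  have := sq_lt_sq_of_radii ha hab
  apply Real.smoothTransition.zero_of_nonpos
  exact div_nonpos_of_nonpos_of_nonneg (by linarith) (by linarith)

/-- `0 ≤ φ`. [folklore] -/
theorem cutoff_nonneg (a b s : ℝ) : 0 ≤ cutoff a b s := Real.smoothTransition.nonneg _

/-- `φ ≤ 1`. [folklore] -/
theorem cutoff_le_one (a b s : ℝ) : cutoff a b s ≤ 1 := Real.smoothTransition.le_one _

/-- `φ` is antitone in `s` (for `0 ≤ a < b`). [folklore] -/
theorem cutoff_antitone (ha : 0 ≤ a) (hab : a < b) : Antitone (cutoff a b) := by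
  intro s t hst
  unfold cutoff
  have := sq_lt_sq_of_radii ha hab
  apply Real.smoothTransition.monotone
  exact div_le_div_of_nonneg_right (by linarith) (by linarith)

/-- `φ` is smooth in `s`. [folklore] -/
theorem contDiff_cutoff (a b : ℝ) {n : ℕ∞} : ContDiff ℝ n (cutoff a b) := by
  unfold cutoff
  exact Real.smoothTransition.contDiff.comp ((contDiff_const.sub contDiff_id).div_const _)

/-- The quotient profile `η₁(s) = M φ(s)`: the value of `ω_θ / r` of the smoothed Hill vortex at
`|x|² = s`. [folklore] -/
def quot (M a b s : ℝ) : ℝ := M * cutoff a b s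

/-- `η₁ = M` on the core `s ≤ a²`. [folklore] -/
theorem quot_of_le (ha : 0 ≤ a) (hab : a < b) {s : ℝ} (hs : s ≤ a ^ 2) : quot M a b s = M := by
  simp [quot, cutoff_of_le ha hab hs]

/-- `η₁ = 0` off `s ≥ b²`. [folklore] -/
theorem quot_of_ge (ha : 0 ≤ a) (hab : a < b) {s : ℝ} (hs : b ^ 2 ≤ s) : quot M a b s = 0 := by
  simp [quot, cutoff_of_ge ha hab hs]

/-- `0 ≤ η₁` (for `0 ≤ M`). [folklore] -/
theorem quot_nonneg (hM : 0 ≤ M) (a b s : ℝ) : 0 ≤ quot M a b s :=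
  mul_nonneg hM (cutoff_nonneg a b s)

/-- `η₁ ≤ M` (for `0 ≤ M`). [folklore] -/
theorem quot_le (hM : 0 ≤ M) (a b s : ℝ) : quot M a b s ≤ M := by
  have h := mul_le_mul_of_nonneg_left (cutoff_le_one a b s) hM
  rw [mul_one] at h
  exact h

/-- `η₁` is antitone in `s` (for `0 ≤ M`, `0 ≤ a < b`). [folklore] -/
theorem quot_antitone (hM : 0 ≤ M) (ha : 0 ≤ a) (hab : a < b) : Antitone (quot M a b) :=
  fun _ _ hst => mul_le_mul_of_nonneg_left (cutoff_antitone ha hab hst) hM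

/-- `η₁` is smooth. [folklore] -/
theorem contDiff_quot (M a b : ℝ) {n : ℕ∞} : ContDiff ℝ n (quot M a b) :=
  contDiff_const.mul (contDiff_cutoff a b)

/-- `η₁` is continuous. [folklore] -/
theorem continuous_quot (M a b : ℝ) : Continuous (quot M a b) :=
  (contDiff_quot M a b (n := 0)).continuous

/-! ## The slope `g'` -/

/-- The slope profile `g'(s) = −½ ∫₀¹ τ⁴ η₁(s τ²) dτ` (for `s > 0` this is
`−½ s^{-5/2} ∫₀^{√s} ρ⁴ η₁(ρ²) dρ`; written as a parametric integral it is manifestly smooth at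
`s = 0`). [folklore] -/
def slope (M a b s : ℝ) : ℝ := -(1 / 2) * ∫ τ in (0 : ℝ)..1, τ ^ 4 * quot M a b (s * τ ^ 2)

/-- The slope is smooth in `s` (smooth dependence of parametric integrals). [folklore] -/
theorem contDiff_slope (M a b : ℝ) {n : ℕ∞} : ContDiff ℝ n (slope M a b) := by
  unfold slope
  refine contDiff_const.mul ?_
  have h : ContDiff ℝ n (Function.uncurry fun (s τ : ℝ) => τ ^ 4 * quot M a b (s * τ ^ 2)) := by
    have h1 : ContDiff ℝ n (fun p : ℝ × ℝ => p.2 ^ 4 * quot M a b (p.1 * p.2 ^ 2)) :=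
      (contDiff_snd.pow 4).mul ((contDiff_quot M a b).comp (contDiff_fst.mul (contDiff_snd.pow 2)))
    exact h1
  exact Literature.Analysis.Calculus.contDiff_intervalIntegral h 0 1

/-- The slope is continuous. [folklore] -/
theorem continuous_slope (M a b : ℝ) : Continuous (slope M a b) :=
  (contDiff_slope M a b (n := 0)).continuous

/-- On the core `s ≤ a²` (`0 ≤ a < b`): `g'(s) = −M/10`. [folklore] -/
theorem slope_of_le (ha : 0 ≤ a) (hab : a < b) {s : ℝ} (hs : s ≤ a ^ 2) :
    slope M a b s = -(M / 10) := by
  unfold slope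
  have h : ∀ τ ∈ uIcc (0 : ℝ) 1, τ ^ 4 * quot M a b (s * τ ^ 2) = M * τ ^ 4 := by
    intro τ hτ
    rw [uIcc_of_le zero_le_one] at hτ
    have hτ2 : τ ^ 2 ≤ 1 := by nlinarith [hτ.1, hτ.2]
    have hst : s * τ ^ 2 ≤ a ^ 2 := by
      rcases le_or_gt 0 s with h0 | h0
      · nlinarith
      · nlinarith [sq_nonneg τ]
    rw [quot_of_le ha hab hst]; ring
  rw [integral_congr h, intervalIntegral.integral_const_mul, integral_pow]
  norm_num
  ring

/-- `−M/10 ≤ g' ≤ 0` (for `0 ≤ M`). [folklore] -/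
theorem slope_mem (hM : 0 ≤ M) (a b s : ℝ) : slope M a b s ∈ Icc (-(M / 10)) 0 := by
  unfold slope
  have hint : IntervalIntegrable (fun τ : ℝ => τ ^ 4 * quot M a b (s * τ ^ 2)) volume 0 1 :=
    ((continuous_pow 4).mul ((continuous_quot M a b).comp
      (continuous_const.mul (continuous_pow 2)))).intervalIntegrable _ _
  have hlo : 0 ≤ ∫ τ in (0 : ℝ)..1, τ ^ 4 * quot M a b (s * τ ^ 2) :=
    integral_nonneg zero_le_one fun τ hτ => mul_nonneg (pow_nonneg hτ.1 4) (quot_nonneg hM _ _ _)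
  have hhi : ∫ τ in (0 : ℝ)..1, τ ^ 4 * quot M a b (s * τ ^ 2) ≤ ∫ τ in (0 : ℝ)..1, M * τ ^ 4 := by
    refine integral_mono_on zero_le_one hint
      ((continuous_const.mul (continuous_pow 4)).intervalIntegrable _ _) fun τ hτ => ?_
    rw [mul_comm]
    exact mul_le_mul_of_nonneg_right (quot_le hM _ _ _) (pow_nonneg hτ.1 4)
  rw [intervalIntegral.integral_const_mul, integral_pow] at hhi
  norm_num at hhi
  constructor <;> nlinarith

/-! ## The running fourth moment and the tail constant -/

/-- The running moment `m(c) = ∫₀ᶜ ρ⁴ η₁(ρ²) dρ`. [folklore] -/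
def moment (M a b c : ℝ) : ℝ := ∫ ρ in (0 : ℝ)..c, ρ ^ 4 * quot M a b (ρ ^ 2)

/-- The tail constant `K = m(b) = ∫₀ᵇ ρ⁴ η₁(ρ²) dρ` (the field is the point dipole
`x ↦ (K/3)|x|⁻³`-potential outside the ball of radius `b`). [folklore] -/
def tailConst (M a b : ℝ) : ℝ := moment M a b b

/-- The moment integrand is interval integrable. [folklore] -/
theorem intervalIntegrable_moment_integrand (M a b c d : ℝ) :
    IntervalIntegrable (fun ρ : ℝ => ρ ^ 4 * quot M a b (ρ ^ 2)) volume c d :=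
  ((continuous_pow 4).mul ((continuous_quot M a b).comp (continuous_pow 2))).intervalIntegrable _ _

/-- On the core: `m(c) = M c⁵ / 5` for `0 ≤ c ≤ a`. [folklore] -/
theorem moment_of_le (ha : 0 ≤ a) (hab : a < b) {c : ℝ} (hc0 : 0 ≤ c) (hc : c ≤ a) :
    moment M a b c = M * c ^ 5 / 5 := by
  unfold moment
  have h : ∀ ρ ∈ uIcc (0 : ℝ) c, ρ ^ 4 * quot M a b (ρ ^ 2) = M * ρ ^ 4 := by
    intro ρ hρ
    rw [uIcc_of_le hc0] at hρ
    have : ρ ^ 2 ≤ a ^ 2 := by nlinarith [hρ.1, hρ.2]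
    rw [quot_of_le ha hab this]; ring
  rw [integral_congr h, intervalIntegral.integral_const_mul, integral_pow]
  ring

/-- Beyond the support: `m(c) = K` for `b ≤ c` (`0 ≤ a < b`). [folklore] -/
theorem moment_of_ge (ha : 0 ≤ a) (hab : a < b) {c : ℝ} (hc : b ≤ c) :
    moment M a b c = tailConst M a b := by
  unfold tailConst moment
  rw [← integral_add_adjacent_intervals (intervalIntegrable_moment_integrand M a b 0 b)
    (intervalIntegrable_moment_integrand M a b b c)]
  have h : ∀ ρ ∈ uIcc b c, ρ ^ 4 * quot M a b (ρ ^ 2) = 0 := by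
    intro ρ hρ
    rw [uIcc_of_le hc] at hρ
    have hb : 0 ≤ b := ha.trans hab.le
    have : b ^ 2 ≤ ρ ^ 2 := by nlinarith [hρ.1]
    rw [quot_of_ge ha hab this, mul_zero]
  rw [integral_congr h, intervalIntegral.integral_zero, add_zero]

/-- The running moment is monotone on `[0, ∞)` (nonnegative integrand). [folklore] -/
theorem moment_mono (hM : 0 ≤ M) {c d : ℝ} (hc : 0 ≤ c) (hcd : c ≤ d) :
    moment M a b c ≤ moment M a b d := by
  unfold moment
  exact integral_mono_interval le_rfl hc hcd
    (Filter.Eventually.of_forall fun ρ => mul_nonneg (by positivity) (quot_nonneg hM _ _ _))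
    (intervalIntegrable_moment_integrand M a b 0 d)

/-- Lower bound `M a⁵/5 ≤ K`. [folklore] -/
theorem tailConst_ge (hM : 0 ≤ M) (ha : 0 ≤ a) (hab : a < b) :
    M * a ^ 5 / 5 ≤ tailConst M a b := by
  rw [← moment_of_le ha hab ha le_rfl]
  exact moment_mono hM ha hab.le

/-- Upper bound `K ≤ M b⁵/5`. [folklore] -/
theorem tailConst_le (hM : 0 ≤ M) (ha : 0 ≤ a) (hab : a < b) :
    tailConst M a b ≤ M * b ^ 5 / 5 := by
  unfold tailConst moment
  have hb : 0 ≤ b := ha.trans hab.le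
  calc ∫ ρ in (0 : ℝ)..b, ρ ^ 4 * quot M a b (ρ ^ 2)
      ≤ ∫ ρ in (0 : ℝ)..b, M * ρ ^ 4 := by
        refine integral_mono_on hb (intervalIntegrable_moment_integrand M a b 0 b)
          ((continuous_const.mul (continuous_pow 4)).intervalIntegrable _ _) fun ρ hρ => ?_
        rw [mul_comm]
        exact mul_le_mul_of_nonneg_right (quot_le hM _ _ _) (by positivity)
    _ = M * b ^ 5 / 5 := by rw [intervalIntegral.integral_const_mul, integral_pow]; ring

/-- `0 ≤ K`. [folklore] -/
theorem tailConst_nonneg (hM : 0 ≤ M) (ha : 0 ≤ a) (hab : a < b) : 0 ≤ tailConst M a b :=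
  le_trans (by positivity) (tailConst_ge hM ha hab)

/-- **Substitution**: for `s > 0`, `g'(s) = −½ · m(√s) / (s² √s)`. [folklore] -/
theorem slope_eq_moment {s : ℝ} (hs : 0 < s) :
    slope M a b s = -(1 / 2) * (moment M a b (Real.sqrt s) / (s ^ 2 * Real.sqrt s)) := by
  unfold slope moment
  congr 1
  have hc : Real.sqrt s ≠ 0 := (Real.sqrt_pos.2 hs).ne'
  have hcs : Real.sqrt s ^ 2 = s := Real.sq_sqrt hs.le
  have h1 : ∫ τ in (0 : ℝ)..1, τ ^ 4 * quot M a b (s * τ ^ 2) =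
      (Real.sqrt s)⁻¹ * ∫ ρ in (0 : ℝ)..Real.sqrt s, (ρ / Real.sqrt s) ^ 4 * quot M a b (ρ ^ 2) := by
    have h := intervalIntegral.integral_comp_mul_left
      (fun ρ : ℝ => (ρ / Real.sqrt s) ^ 4 * quot M a b (ρ ^ 2)) hc (a := 0) (b := 1)
    simp only [mul_zero, mul_one, smul_eq_mul] at h
    rw [← h]
    refine integral_congr fun τ _ => ?_
    show τ ^ 4 * quot M a b (s * τ ^ 2) =
      (Real.sqrt s * τ / Real.sqrt s) ^ 4 * quot M a b ((Real.sqrt s * τ) ^ 2)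
    rw [mul_div_cancel_left₀ τ hc, mul_pow, hcs]
  have h2 : ∫ ρ in (0 : ℝ)..Real.sqrt s, (ρ / Real.sqrt s) ^ 4 * quot M a b (ρ ^ 2) =
      (Real.sqrt s ^ 4)⁻¹ * ∫ ρ in (0 : ℝ)..Real.sqrt s, ρ ^ 4 * quot M a b (ρ ^ 2) := by
    rw [← intervalIntegral.integral_const_mul]
    refine integral_congr fun ρ _ => ?_
    rw [div_pow]; ring
  rw [h1, h2]
  have h4 : Real.sqrt s ^ 4 = s ^ 2 := by nlinarith [hcs]
  rw [h4]
  field_simp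

/-- **The dipole tail of the slope**: for `b² ≤ s` (`0 < b`), `g'(s) = −(K/2) / (s² √s)`.
[folklore] -/
theorem slope_of_ge (ha : 0 ≤ a) (hab : a < b) {s : ℝ} (hs : b ^ 2 ≤ s) :
    slope M a b s = -(tailConst M a b / 2) / (s ^ 2 * Real.sqrt s) := by
  have hb : 0 < b := lt_of_le_of_lt ha hab
  have hs0 : 0 < s := lt_of_lt_of_le (by positivity) hs
  rw [slope_eq_moment hs0, moment_of_ge ha hab]
  · ring
  · calc b = Real.sqrt (b ^ 2) := (Real.sqrt_sq hb.le).symm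
      _ ≤ Real.sqrt s := Real.sqrt_le_sqrt hs

/-- Lower bound off the core: for `a² ≤ s` (`0 < a`), `−g'(s) ≥ (M a⁵/10) / (s² √s)`. [folklore] -/
theorem neg_slope_ge (hM : 0 ≤ M) (ha : 0 < a) (hab : a < b) {s : ℝ} (hs : a ^ 2 ≤ s) :
    M * a ^ 5 / 10 / (s ^ 2 * Real.sqrt s) ≤ -slope M a b s := by
  have hs0 : 0 < s := lt_of_lt_of_le (by positivity) hs
  have hsq : 0 < Real.sqrt s := Real.sqrt_pos.2 hs0
  rw [slope_eq_moment hs0]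
  have hle : a ≤ Real.sqrt s := by
    calc a = Real.sqrt (a ^ 2) := (Real.sqrt_sq ha.le).symm
      _ ≤ Real.sqrt s := Real.sqrt_le_sqrt hs
  have hm : M * a ^ 5 / 5 ≤ moment M a b (Real.sqrt s) := by
    rw [← moment_of_le ha.le hab ha.le le_rfl]
    exact moment_mono hM ha.le hle
  have hden : 0 < s ^ 2 * Real.sqrt s := by positivity
  rw [show -(-(1 / 2) * (moment M a b (Real.sqrt s) / (s ^ 2 * Real.sqrt s))) =
    (moment M a b (Real.sqrt s) / 2) / (s ^ 2 * Real.sqrt s) by ring]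
  exact div_le_div_of_nonneg_right (by linarith) hden.le

/-! ## The vorticity identity `η₁ = −(10 g' + 4 s g'')` -/

/-- The running moment is a primitive of `c ↦ c⁴ η₁(c²)`. [folklore] -/
theorem hasDerivAt_moment (M a b c : ℝ) :
    HasDerivAt (moment M a b) (c ^ 4 * quot M a b (c ^ 2)) c :=
  (((continuous_pow 4).mul ((continuous_quot M a b).comp (continuous_pow 2))).integral_hasStrictDerivAt
    0 c).hasDerivAt

/-- `g'' = 0` on the open core `s < a²`. [folklore] -/
theorem deriv_slope_of_lt (ha : 0 ≤ a) (hab : a < b) {s : ℝ} (hs : s < a ^ 2) :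
    deriv (slope M a b) s = 0 := by
  have h : slope M a b =ᶠ[nhds s] fun _ => -(M / 10) := by
    filter_upwards [Iio_mem_nhds hs] with σ hσ using slope_of_le ha hab hσ.le
  rw [h.deriv_eq, deriv_const]

/-- **The vorticity identity** (`0 < a < b`): for every `s`,
`η₁(s) = −(10 g'(s) + 4 s g''(s))`. With `u = curl (g(|x|²) e_z × x)` this is `curl u = η₁(|x|²) e_z × x`,
i.e. `ω_θ / r = η₁(|x|²)`. On the core both sides are `M`; for `s > 0` it follows from
`g'(s) = −½ m(√s) s^{-5/2}` and `m'(c) = c⁴ η₁(c²)`. [folklore] -/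
theorem quot_eq_slope_deriv (ha : 0 < a) (hab : a < b) (s : ℝ) :
    quot M a b s = -(10 * slope M a b s + 4 * s * deriv (slope M a b) s) := by
  rcases lt_or_ge s (a ^ 2) with h | h
  · rw [deriv_slope_of_lt ha.le hab h, slope_of_le ha.le hab h.le, quot_of_le ha.le hab h.le]
    ring
  · have hs : 0 < s := lt_of_lt_of_le (by positivity) h
    -- write `s = c²`
    obtain ⟨c, hc, rfl⟩ : ∃ c : ℝ, 0 < c ∧ s = c ^ 2 := ⟨Real.sqrt s, Real.sqrt_pos.2 hs,
      (Real.sq_sqrt hs.le).symm⟩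
    have hsq : ∀ᶠ σ in nhds (c ^ 2), 0 < σ := Ioi_mem_nhds hs
    -- the explicit formula near `c²`
    have hF : HasDerivAt (fun σ : ℝ => -(1 / 2) * (moment M a b (Real.sqrt σ) / (σ ^ 2 * Real.sqrt σ)))
        (-(1 / 2) * (((Real.sqrt (c ^ 2) ^ 4 * quot M a b (Real.sqrt (c ^ 2) ^ 2)) *
            (1 / (2 * Real.sqrt (c ^ 2))) * (((c ^ 2) ^ 2) * Real.sqrt (c ^ 2)) -
          moment M a b (Real.sqrt (c ^ 2)) *
            (↑(2 : ℕ) * (c ^ 2) ^ (2 - 1) * Real.sqrt (c ^ 2) + (c ^ 2) ^ 2 * (1 / (2 * Real.sqrt (c ^ 2))))) /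
          (((c ^ 2) ^ 2) * Real.sqrt (c ^ 2)) ^ 2)) (c ^ 2) := by
      have hm := (hasDerivAt_moment M a b (Real.sqrt (c ^ 2))).comp (c ^ 2)
        (Real.hasDerivAt_sqrt hs.ne')
      have hd := (hasDerivAt_pow 2 (c ^ 2)).mul (Real.hasDerivAt_sqrt hs.ne')
      have hne : (c ^ 2) ^ 2 * Real.sqrt (c ^ 2) ≠ 0 := by positivity
      exact ((hm.div hd hne).const_mul (-(1 / 2)))
    have hF' : HasDerivAt (slope M a b) _ (c ^ 2) := hF.congr_of_eventuallyEq
      (by filter_upwards [hsq] with σ hσ using slope_eq_moment hσ)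
    rw [hF'.deriv, slope_eq_moment hs, Real.sqrt_sq hc.le]
    push_cast
    field_simp
    ring

end SmoothedHill

end Summit.NavierStokesRegularity.FluidComputer

end
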